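import Summits.Ventures.HodgeRepro2.T5DvrFiniteQuotients
import Summits.Ventures.HodgeRepro2.T5GelfandTransport

/-!
# The spherical Hecke algebra at a split place: any group isomorphic to `GL_n(F)`

Tier-5 kernel support (blind cell pub-hodge-repro2, seat p8, gen 11). At a split place `v` of
`E/F` the record's unitary group is `U(V_v) ≅ GL_n(F_v)` with the hyperspecial `K_v` carried onto
`GL_n(𝒪_v)`. This file composes T5-105 (commutativity for `GL_n(F)`, `K = GL_n(R)`) with T5-106
(transport of Gelfand's trick along an isomorphism): for ANY group `G'` with a subgroup `K'` and
an isomorphism `e : G' ≃* GL_n(F)` with `e(K') = GL_n(R)`, the spherical Hecke algebra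
`H(G', K')` is commutative.

* `heckeAlgebra_mul_comm_of_equiv_of_finite_quotients` — for a PID `R` with `(Q)`;
* `heckeAlgebra_mul_comm_of_equiv` — **for `R` a discrete valuation ring with finite residue
  field** (the record's `𝒪_v`), no remaining hypothesis.

What stays prose: the isomorphism `U(V_v) ≅ GL_n(F_v)` at a split place and the identification
of `K_v` with `GL_n(𝒪_v)` under it (the objects `U(V_v)`, `K_v` of the record are not in the
tree's vocabulary); the inert places.
-/

namespace Summit.Ventures.HodgeRepro2.T5SplitPlaceHecke

open MulOpposite

variable {R : Type*} [CommRing R] [IsDomain R] {F : Type*} [Field F] [Algebra R F]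
  [IsFractionRing R F] {ι : Type*} [Fintype ι] [DecidableEq ι]
variable {G' : Type*} [Group G'] {K' : Subgroup G'}

/-- `H(G', K')` is commutative when `G' ≅ GL_n(F)` carries `K'` onto `GL_n(R)`, `R` a PID whose
non-zero principal quotients are finite. -/
theorem heckeAlgebra_mul_comm_of_equiv_of_finite_quotients [IsPrincipalIdealRing R]
    (k : Type*) [Field k] (hq : ∀ c : R, c ≠ 0 → Finite (R ⧸ Ideal.span {c}))
    (e : G' ≃* GL ι F)
    (he : ∀ x, e x ∈ (Matrix.GeneralLinearGroup.map (n := ι) (algebraMap R F)).range ↔ x ∈ K')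
    (T S : T5HeckePermutationModule.heckeAlgebra k K') : T * S = S * T :=
  T5GelfandTransport.heckeAlgebra_mul_comm_of_equiv k e he
    (fun g => T5CongruenceOrbitFinite.finite_orbit_of_finite_quotients hq g)
    T5CartanTransposeGelfand.transposeAntiAut
    (fun y => T5CartanTransposeGelfand.unop_transposeAntiAut_mem_iff (R := R) y)
    (fun y => T5CartanTransposeGelfand.unop_transposeAntiAut_mem_orbit (R := R) y) T S

/-- **The spherical Hecke algebra at a split place is commutative**: `G' ≅ GL_n(F)` with `K'`
carried onto `GL_n(R)`, `R` a discrete valuation ring with finite residue field, `F` its fraction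
field — no remaining hypothesis. -/
theorem heckeAlgebra_mul_comm_of_equiv [IsDiscreteValuationRing R]
    [Finite (IsLocalRing.ResidueField R)] (k : Type*) [Field k] (e : G' ≃* GL ι F)
    (he : ∀ x, e x ∈ (Matrix.GeneralLinearGroup.map (n := ι) (algebraMap R F)).range ↔ x ∈ K')
    (T S : T5HeckePermutationModule.heckeAlgebra k K') : T * S = S * T :=
  heckeAlgebra_mul_comm_of_equiv_of_finite_quotients k
    (fun c hc => T5DvrFiniteQuotients.finite_quotient_span_singleton c hc) e he T S

end Summit.Ventures.HodgeRepro2.T5SplitPlaceHecke
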